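import Literature.MathematicalPhysics.QuantumFieldTheory.Balaban1983to89.MatrixLogLipschitz
import Summits.QuantumFields.BalabanUV.T4Continuum.Support.NE7AxialRecursionLetters
import HarnessLib

/-!
# NE7MatrixLogSecondDiff — THE SERIES LOGARITHM (21) of [Balaban1985Averaging] §A HAS BOUNDED MIXED SECOND DIFFERENCES on every ball `‖X − 1‖ ≤ r < 1`:
# for four corner values `A` (base), `B`, `C` (the two unit shifts), `D` (both) with `‖· − 1‖ ≤ r`, first differences `≤ h` resp. `≤ v`,
#   `‖log D − log B − log C + log A‖ ≤ ‖D − B − C + A‖∕(1 − r) + h·v∕(1 − r)²`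
# — the `C^{1,1}` companion of ymgap's `MatrixLogLipschitz.norm_mlog_sub_mlog_le` (`(1 − r)⁻¹`-Lipschitz)

Cell `pub-balaban`, rung (B)+1 sub-cell t4, lineage `b2b-balaban-t4-ne7-p1` (CRUX PROVER NE7 #1 = OWNER of BINDER row NE7), generation 111.  Memo
`t4/b2b-balaban-t4-ne7-p1-g111/ROAD-G111.md`.  File F4a of the line «(9)-TYPE k-UNIFORM HÖLDER REGULARITY OF EVERY CONSTRAINED SMALL-FIELD MINIMISER, every β < 1»
(ROAD-G110 §NEXT (N2)); consumed by F4b `NE7AxialGaugePotentialHolder` (second differences of `B = log U^{v₀}` from those of `U^{v₀}`).  (Offered to row NE7b as an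
INTERFACE REQUEST in [NE7P1-G111-INBOX-1]; written by the owner to keep the line moving.)
THE ARGUMENT.  Termwise in `log(1 + x) = Σ_{n ≥ 1} (−1)^{n+1}xⁿ∕n` (`Literature.Analysis.Complex.logOnePlus`, `‖logSeriesCoeff (n+1)‖ = 1∕(n+1)`): with the two-factor
identity of F1 (`NE7AxialRecursionLetters.norm_mul_secondDiff_le`) at `f = x`, `g = x^{n+1}` and the telescoping `‖x^{n+1} − y^{n+1}‖ ≤ (n+1)rⁿ‖x − y‖`,
`‖Δ²(x^{n+2})‖ ≤ (n+2)r^{n+1}‖Δ²x‖ + (n+2)(n+1)rⁿ·hv` by induction; then `Σ_{n ≥ 1} r^{n−1} = (1 − r)⁻¹`, `Σ_{n ≥ 2}(n−1)r^{n−2} = (1 − r)⁻²`.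
WHAT ([folklore]; 0 def, 0 sorry; any complete normed `ℂ`-algebra).  (private: `norm_pow_succ_sub_le`, `hasSum_succ_mul_geometric`), `norm_pow_secondDiff_le`,
**`norm_logOnePlus_secondDiff_le`**, **`norm_mlog_secondDiff_le`**.
HONEST FRAMING (page 1): kernel facts about a power series; nothing of Bałaban's asserted; NOT NE3∕NE7 as spine nodes; spine 0∕9; finite T⁴ rung (B)+1 — NOT infinite volume,
NOT mass gap, NOT BetaPertH, NOT Clay.
-/

set_option autoImplicit false

open NormedSpace

namespace Summit.QuantumFields.BalabanUV.T4Continuum.NE7MatrixLogSecondDiff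

open Literature.Analysis.Complex (logOnePlus logSeriesCoeff summable_logOnePlus)
open Literature.MathematicalPhysics.QuantumFieldTheory.Balaban1983to89
open MatrixLog (mlog mlog_def norm_logSeriesCoeff_succ)
open NE7AxialRecursionLetters (norm_mul_secondDiff_le)

noncomputable section

variable {𝔄 : Type*} [NormedRing 𝔄] [NormedAlgebra ℂ 𝔄]

/-! ## §1 Powers: first and mixed second differences -/

omit [NormedAlgebra ℂ 𝔄] in
/-- Non-commutative telescoping: `‖x^{n+1} − y^{n+1}‖ ≤ (n+1)·rⁿ·‖x − y‖` for `‖x‖, ‖y‖ ≤ r` (ymgap's private letter; also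
`YMDAG.N18.TransportOfRecord.norm_pow_succ_sub_pow_succ_le_of_le`, not imported to keep the closure small — kept PRIVATE here). [folklore] -/
private theorem norm_pow_succ_sub_le {x y : 𝔄} {r : ℝ} (hx : ‖x‖ ≤ r) (hy : ‖y‖ ≤ r) :
    ∀ n : ℕ, ‖x ^ (n + 1) - y ^ (n + 1)‖ ≤ (n + 1) * r ^ n * ‖x - y‖
  | 0 => by simp
  | n + 1 => by
    have hr : 0 ≤ r := (norm_nonneg x).trans hx
    have ih := norm_pow_succ_sub_le hx hy n
    have e : x ^ (n + 2) - y ^ (n + 2) = x * (x ^ (n + 1) - y ^ (n + 1)) + (x - y) * y ^ (n + 1) := by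
      simp only [pow_succ']; noncomm_ring
    rw [e]
    calc ‖x * (x ^ (n + 1) - y ^ (n + 1)) + (x - y) * y ^ (n + 1)‖
        ≤ ‖x‖ * ‖x ^ (n + 1) - y ^ (n + 1)‖ + ‖x - y‖ * ‖y ^ (n + 1)‖ :=
          (norm_add_le _ _).trans (add_le_add (norm_mul_le _ _) (norm_mul_le _ _))
      _ ≤ r * ((n + 1) * r ^ n * ‖x - y‖) + ‖x - y‖ * r ^ (n + 1) := by
          refine add_le_add (mul_le_mul hx ih (norm_nonneg _) hr) (mul_le_mul_of_nonneg_left ?_ (norm_nonneg _))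
          exact (norm_pow_le' y (Nat.succ_pos n)).trans (pow_le_pow_left₀ (norm_nonneg y) hy _)
      _ = ((n + 1 : ℕ) + 1) * r ^ (n + 1) * ‖x - y‖ := by push_cast; ring

omit [NormedAlgebra ℂ 𝔄] in
/-- **Mixed second differences of powers**: four corner values of norm `≤ r` with first differences `≤ h` (first direction) and `≤ v` (second direction):
`‖Δ²(x^{n+2})‖ ≤ (n+2)·r^{n+1}·‖Δ²x‖ + (n+2)(n+1)·rⁿ·h·v`. [folklore] -/
theorem norm_pow_secondDiff_le {x₀₀ x₁₀ x₀₁ x₁₁ : 𝔄} {r h v : ℝ}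
    (h00 : ‖x₀₀‖ ≤ r) (h10 : ‖x₁₀‖ ≤ r) (h01 : ‖x₀₁‖ ≤ r) (h11 : ‖x₁₁‖ ≤ r)
    (hh0 : ‖x₁₀ - x₀₀‖ ≤ h) (hh1 : ‖x₁₁ - x₀₁‖ ≤ h) (hv0 : ‖x₀₁ - x₀₀‖ ≤ v) (hv1 : ‖x₁₁ - x₁₀‖ ≤ v) :
    ∀ n : ℕ, ‖x₁₁ ^ (n + 2) - x₁₀ ^ (n + 2) - x₀₁ ^ (n + 2) + x₀₀ ^ (n + 2)‖
      ≤ (n + 2) * r ^ (n + 1) * ‖x₁₁ - x₁₀ - x₀₁ + x₀₀‖ + (n + 2) * (n + 1) * r ^ n * (h * v) := by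
  have hr : 0 ≤ r := (norm_nonneg _).trans h00
  have hh : 0 ≤ h := (norm_nonneg _).trans hh0
  have hv : 0 ≤ v := (norm_nonneg _).trans hv0
  intro n
  induction n with
  | zero =>
    have e : x₁₁ ^ (0 + 2) - x₁₀ ^ (0 + 2) - x₀₁ ^ (0 + 2) + x₀₀ ^ (0 + 2) = x₁₁ * x₁₁ - x₁₀ * x₁₀ - x₀₁ * x₀₁ + x₀₀ * x₀₀ := by
      simp only [zero_add, pow_two]
    rw [e]
    have hstep := norm_mul_secondDiff_le (le_refl ‖x₁₁ - x₁₀ - x₀₁ + x₀₀‖) (le_refl ‖x₁₁ - x₁₀ - x₀₁ + x₀₀‖) hh0 hv0 hv1 hh1 h11 h00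
    refine hstep.trans (le_of_eq ?_)
    push_cast
    ring
  | succ n ih =>
    have e : x₁₁ ^ (n + 1 + 2) - x₁₀ ^ (n + 1 + 2) - x₀₁ ^ (n + 1 + 2) + x₀₀ ^ (n + 1 + 2)
        = x₁₁ * x₁₁ ^ (n + 2) - x₁₀ * x₁₀ ^ (n + 2) - x₀₁ * x₀₁ ^ (n + 2) + x₀₀ * x₀₀ ^ (n + 2) := by
      simp only [show n + 1 + 2 = (n + 2) + 1 by ring, pow_succ']
    rw [e]
    have gv : ‖x₁₁ ^ (n + 2) - x₁₀ ^ (n + 2)‖ ≤ (((n + 1 : ℕ) : ℝ) + 1) * r ^ (n + 1) * v :=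
      (norm_pow_succ_sub_le h11 h10 (n + 1)).trans (mul_le_mul_of_nonneg_left hv1 (by positivity))
    have gh : ‖x₁₁ ^ (n + 2) - x₀₁ ^ (n + 2)‖ ≤ (((n + 1 : ℕ) : ℝ) + 1) * r ^ (n + 1) * h :=
      (norm_pow_succ_sub_le h11 h01 (n + 1)).trans (mul_le_mul_of_nonneg_left hh1 (by positivity))
    have gD : ‖x₁₁ ^ (n + 2)‖ ≤ r ^ (n + 2) := (norm_pow_le' _ (by omega)).trans (pow_le_pow_left₀ (norm_nonneg _) h11 _)
    have hstep := norm_mul_secondDiff_le (le_refl ‖x₁₁ - x₁₀ - x₀₁ + x₀₀‖) ih hh0 hv0 gv gh gD h00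
    calc _ ≤ ‖x₁₁ - x₁₀ - x₀₁ + x₀₀‖ * r ^ (n + 2) + h * ((((n + 1 : ℕ) : ℝ) + 1) * r ^ (n + 1) * v)
            + v * ((((n + 1 : ℕ) : ℝ) + 1) * r ^ (n + 1) * h)
            + r * ((n + 2) * r ^ (n + 1) * ‖x₁₁ - x₁₀ - x₀₁ + x₀₀‖ + (n + 2) * (n + 1) * r ^ n * (h * v)) := hstep
      _ = ((n + 1 : ℕ) + 2) * r ^ (n + 1 + 1) * ‖x₁₁ - x₁₀ - x₀₁ + x₀₀‖ + ((n + 1 : ℕ) + 2) * ((n + 1 : ℕ) + 1) * r ^ (n + 1) * (h * v) := by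
          push_cast; ring

/-! ## §2 The series -/

/-- `Σ_{n ≥ 0} (n+1)·rⁿ = (1 − r)⁻²` for `0 ≤ r < 1` (also `Literature.Barriers.CriticalPhenomena.SpreadOutIsing.hasSum_coe_add_one_mul_pow`, not imported —
kept PRIVATE here). [folklore] -/
private theorem hasSum_succ_mul_geometric {r : ℝ} (hr0 : 0 ≤ r) (hr : r < 1) :
    HasSum (fun n : ℕ => ((n : ℝ) + 1) * r ^ n) (1 / (1 - r) ^ 2) := by
  have h1 : HasSum (fun n : ℕ => (n : ℝ) * r ^ n) (r / (1 - r) ^ 2) :=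
    hasSum_coe_mul_geometric_of_norm_lt_one (by rw [Real.norm_eq_abs, abs_of_nonneg hr0]; exact hr)
  have h2 : HasSum (fun n : ℕ => r ^ n) (1 - r)⁻¹ := hasSum_geometric_of_lt_one hr0 hr
  have h := h1.add h2
  have hne : (1 - r) ≠ 0 := by linarith
  convert h using 1
  · funext n; ring
  · field_simp; ring

variable [CompleteSpace 𝔄]

/-- **MIXED SECOND DIFFERENCES OF `log(1 + ·)`** on `‖·‖ ≤ r < 1`: for four corner values with first differences `≤ h`, `≤ v`,
`‖log(1+x₁₁) − log(1+x₁₀) − log(1+x₀₁) + log(1+x₀₀)‖ ≤ ‖x₁₁ − x₁₀ − x₀₁ + x₀₀‖∕(1 − r) + h·v∕(1 − r)²`. [folklore] -/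
theorem norm_logOnePlus_secondDiff_le {x₀₀ x₁₀ x₀₁ x₁₁ : 𝔄} {r h v : ℝ} (hr : r < 1)
    (h00 : ‖x₀₀‖ ≤ r) (h10 : ‖x₁₀‖ ≤ r) (h01 : ‖x₀₁‖ ≤ r) (h11 : ‖x₁₁‖ ≤ r)
    (hh0 : ‖x₁₀ - x₀₀‖ ≤ h) (hh1 : ‖x₁₁ - x₀₁‖ ≤ h) (hv0 : ‖x₀₁ - x₀₀‖ ≤ v) (hv1 : ‖x₁₁ - x₁₀‖ ≤ v) :
    ‖logOnePlus x₁₁ - logOnePlus x₁₀ - logOnePlus x₀₁ + logOnePlus x₀₀‖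
      ≤ ‖x₁₁ - x₁₀ - x₀₁ + x₀₀‖ / (1 - r) + h * v / (1 - r) ^ 2 := by
  have hr0 : 0 ≤ r := (norm_nonneg _).trans h00
  have hh : 0 ≤ h := (norm_nonneg _).trans hh0
  have hv : 0 ≤ v := (norm_nonneg _).trans hv0
  have hs00 := summable_logOnePlus (h00.trans_lt hr)
  have hs10 := summable_logOnePlus (h10.trans_lt hr)
  have hs01 := summable_logOnePlus (h01.trans_lt hr)
  have hs11 := summable_logOnePlus (h11.trans_lt hr)
  set Δ₂ : ℝ := ‖x₁₁ - x₁₀ - x₀₁ + x₀₀‖ with hΔ₂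
  set f : ℕ → 𝔄 := fun n => logSeriesCoeff n • (x₁₁ ^ n - x₁₀ ^ n - x₀₁ ^ n + x₀₀ ^ n) with hf
  have hfs : Summable f := by
    have := ((hs11.sub hs10).sub hs01).add hs00
    refine this.congr fun n => ?_
    simp only [hf, smul_sub, smul_add]
  have e : logOnePlus x₁₁ - logOnePlus x₁₀ - logOnePlus x₀₁ + logOnePlus x₀₀ = ∑' n : ℕ, f n := by
    simp only [logOnePlus]
    rw [← hs11.tsum_sub hs10, ← (hs11.sub hs10).tsum_sub hs01, ← ((hs11.sub hs10).sub hs01).tsum_add hs00]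
    refine tsum_congr fun n => ?_
    simp only [hf, smul_sub, smul_add]
  rw [e, ← hfs.sum_add_tsum_nat_add 2]
  -- the two head terms: `f 0 = 0`, `‖f 1‖ ≤ Δ₂`
  have hf0 : f 0 = 0 := by simp [hf]
  have hf1 : ‖f 1‖ ≤ Δ₂ := by
    have hc : ‖logSeriesCoeff 1‖ = 1 := by rw [show (1 : ℕ) = 0 + 1 from rfl, norm_logSeriesCoeff_succ]; norm_num
    simp only [hf, pow_one]
    refine (norm_smul_le _ _).trans ?_
    rw [hc, one_mul]
  -- the tail against the majorant `r^{n+1}Δ₂ + (n+1)rⁿ·hv`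
  have hmaj : HasSum (fun n : ℕ => r ^ (n + 1) * Δ₂ + ((n : ℝ) + 1) * r ^ n * (h * v)) (r / (1 - r) * Δ₂ + 1 / (1 - r) ^ 2 * (h * v)) := by
    refine HasSum.add ?_ ((hasSum_succ_mul_geometric hr0 hr).mul_right _)
    have hg := (hasSum_geometric_of_lt_one hr0 hr).mul_left r
    have hg' : HasSum (fun n : ℕ => r ^ (n + 1)) (r / (1 - r)) := by
      simp_rw [pow_succ', div_eq_mul_inv]; exact hg
    exact hg'.mul_right _
  have htail : ‖∑' n : ℕ, f (n + 2)‖ ≤ r / (1 - r) * Δ₂ + 1 / (1 - r) ^ 2 * (h * v) := by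
    refine tsum_of_norm_bounded hmaj fun n => ?_
    simp only [hf]
    refine (norm_smul_le _ _).trans ?_
    rw [show n + 2 = (n + 1) + 1 by ring, norm_logSeriesCoeff_succ]
    have hp := norm_pow_secondDiff_le h00 h10 h01 h11 hh0 hh1 hv0 hv1 n
    have hn : (0 : ℝ) < (n : ℝ) + 1 + 1 := by positivity
    calc 1 / (((n + 1 : ℕ) : ℝ) + 1) * ‖x₁₁ ^ (n + 1 + 1) - x₁₀ ^ (n + 1 + 1) - x₀₁ ^ (n + 1 + 1) + x₀₀ ^ (n + 1 + 1)‖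
        ≤ 1 / (((n + 1 : ℕ) : ℝ) + 1) * ((n + 2) * r ^ (n + 1) * Δ₂ + (n + 2) * (n + 1) * r ^ n * (h * v)) :=
          mul_le_mul_of_nonneg_left hp (by positivity)
      _ = r ^ (n + 1) * Δ₂ + ((n : ℝ) + 1) * r ^ n * (h * v) := by
          push_cast
          field_simp
          ring
  have hne : (1 - r) ≠ 0 := by linarith
  calc ‖(∑ i ∈ Finset.range 2, f i) + ∑' n : ℕ, f (n + 2)‖
      ≤ ‖∑ i ∈ Finset.range 2, f i‖ + ‖∑' n : ℕ, f (n + 2)‖ := norm_add_le _ _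
    _ ≤ Δ₂ + (r / (1 - r) * Δ₂ + 1 / (1 - r) ^ 2 * (h * v)) := by
        refine add_le_add ?_ htail
        rw [Finset.sum_range_succ, Finset.sum_range_succ, Finset.sum_range_zero, zero_add, hf0, zero_add]
        exact hf1
    _ = Δ₂ / (1 - r) + h * v / (1 - r) ^ 2 := by field_simp; ring

/-- **MIXED SECOND DIFFERENCES OF THE SERIES LOGARITHM (21)** on `‖X − 1‖ ≤ r < 1`: for four corner values `A` (base), `B` (first shift), `C` (second shift),
`D` (both) with `‖B − A‖, ‖D − C‖ ≤ h` and `‖C − A‖, ‖D − B‖ ≤ v`: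
`‖log D − log B − log C + log A‖ ≤ ‖D − B − C + A‖∕(1 − r) + h·v∕(1 − r)²`. [folklore] -/
theorem norm_mlog_secondDiff_le {A B C D : 𝔄} {r h v : ℝ} (hr : r < 1)
    (hA : ‖A - 1‖ ≤ r) (hB : ‖B - 1‖ ≤ r) (hC : ‖C - 1‖ ≤ r) (hD : ‖D - 1‖ ≤ r)
    (hAB : ‖B - A‖ ≤ h) (hCD : ‖D - C‖ ≤ h) (hAC : ‖C - A‖ ≤ v) (hBD : ‖D - B‖ ≤ v) :
    ‖mlog D - mlog B - mlog C + mlog A‖ ≤ ‖D - B - C + A‖ / (1 - r) + h * v / (1 - r) ^ 2 := by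
  simp only [mlog_def]
  have hAB' : ‖B - 1 - (A - 1)‖ ≤ h := by rwa [sub_sub_sub_cancel_right]
  have hCD' : ‖D - 1 - (C - 1)‖ ≤ h := by rwa [sub_sub_sub_cancel_right]
  have hAC' : ‖C - 1 - (A - 1)‖ ≤ v := by rwa [sub_sub_sub_cancel_right]
  have hBD' : ‖D - 1 - (B - 1)‖ ≤ v := by rwa [sub_sub_sub_cancel_right]
  have hmain := norm_logOnePlus_secondDiff_le (x₀₀ := A - 1) (x₁₀ := B - 1) (x₀₁ := C - 1) (x₁₁ := D - 1) hr hA hB hC hD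
    hAB' hCD' hAC' hBD'
  have e : D - 1 - (B - 1) - (C - 1) + (A - 1) = D - B - C + A := by abel
  rwa [e] at hmain

end

end Summit.QuantumFields.BalabanUV.T4Continuum.NE7MatrixLogSecondDiff
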